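import Summits.AtomisticToContinuum.HydrodynamicLimit.Theses.ResponseRigidity
import HarnessLib

/-!
# Birth skeleton (BC3) for crux `RenewalDefect` — route ResponseRigidity, item stmt-AtomisticToContinuum-15326

Line `birth` = the TRIANGLE SPLIT of the one-sphere renewal defect through the FROZEN-WEIGHT reading under the
Euler-advanced law. The crux (C3, rank 4 of `ResponseRigidity`) compares, for the one-sphere weight
`ψ_τ(q,v) = φ(q)·p((v − u_τ(q))/√θ_τ(q))`, a far-future tested conserved field `Y_s = ⟨U_N(Φ_s·),χ⟩` and the step
`r = d(N+1)^{-1/3}` (`d` mean free times),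

  `A := (N+1)·E_{LG_τ}[ψ_τ(z₀(r))·(Y_s − E Y_s)]`      (weight read AFTER the step, law `P = LG_τ`)
  `B := (N+1)·E_{LG_{τ+r}}[ψ_{τ+r}(z₀(0))·(Y_{s−r} − E' Y_{s−r})]`   (weight read at time 0 under the
                                                          Euler-ADVANCED law `P' = LG_{τ+r}`, horizon shortened)

and asks `|A − B| ≤ κ'·d` for small `d`, `N ≥ N₀(d)`. By the flow property `Φ_s = Φ_{s−r} ∘ Φ_r`, `A` is EXACTLY
the statistic `(N+1)·Cov(ψ_τ(z₀), Y_{s−r})` under the TRANSPORTED law `Φ_r # LG_τ`; by exchangeability every such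
`(N+1)`-amplified one-sphere covariance is the plain covariance `Cov(Σ_i ψ(z_i), Y)` of an extensive one-body sum with
the field. The two readings differ in exactly two things — the LAW (`Φ_r # LG_τ` versus `LG_{τ+r}`) and the local FRAME
of the weight (`(u_τ, θ_τ)` versus `(u_{τ+r}, θ_{τ+r})`) — and the line separates them through the intermediate reading

  `M := (N+1)·E_{LG_{τ+r}}[ψ_τ(z₀(0))·(Y_{s−r} − E' Y_{s−r})]`   (OLD frame, NEW law),

`|A − B| ≤ |A − M| + |M − B|`. Two registered stubs, each stated under the crux prefix VERBATIM (Euler activity family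
`a_τ`, packing guard, LLN of the family, `t, χ, φw, p` of quartic growth, `δ ≤ s`, `s + τ ≤ t`, the same `∃ d₀ ∀ d ∃ N₀`
shape and the same `let`-bound `r, P, P', ψ, ψ'`), differing from the crux only in the final inequality:

* `stub_transportDefect` (T, load-bearing, open-problem) — FROZEN-WEIGHT LAW-TRANSPORT DEFECT `|A − M| ≤ κ'·d`:
  the transported law `Φ_r # LG_τ` and the Euler-advanced law `LG_{τ+r}` — far apart as measures (relative entropy
  `≍ d²N^{1/3}`) — agree to `o(d)` on the single bilinear statistic (extensive `ψ_τ`-sum at time 0) × (centred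
  far-future conserved field). This is the crux's own "three-point (⊥, one-sphere ⊥, future) additivity", now with the
  frame change removed: interpolating along `ρ' ↦ Φ_{r−ρ'} # LG_{τ+ρ'}` (`ρ' ∈ [0,r]`) the `ρ'`-derivative is the mixed
  third cumulant `E[(S_prof − S_dyn)~ · Ψ̃ · Ỹ]` of (profile score − dynamical score of the local Gibbs family, the
  `ψ`-sum, the future field) — exponential-family score in `τ` (Sasa2014, Gaspard2022 §3.2) against the Kawasaki/TTCF
  dynamical score (EvansMorriss2008 Ch. 7) — and Yau's cancellation (Yau1991, OllaVaradhanYau1993 §3) removes the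
  hydrodynamic projection of `S_prof − S_dyn` along an Euler family (virial pressure included), leaving the ⊥-current
  fluctuation paired with `(Ψ, Y)`. An identity (`A = M`) at constant profiles: `Φ_r # LG = LG`, `P' = P`.
* `stub_weightReframing` (S, size L) — WEIGHT RE-FRAMING DEFECT `|M − B| ≤ κ'·d`: under ONE local Gibbs law
  `LG_{τ+r}` the `(N+1)`-amplified covariance of the future field with the frame difference
  `g := ψ_τ − ψ_{τ+r}` (a one-body function that tends to `0` locally uniformly with quartic envelope as `r → 0`, by
  continuity of `p` and time-regularity of the classical solution) is `o(1)`, hence `≤ κ'·d` for `N ≥ N₀(d)`: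
  `Cov_{LG_{τ+r}}(Σ_i g(z_i), Y_{s−r}) ≤ SD(Σ g)·SD(Y) ≤ C√(N+1)‖g‖ · √(C/(N+1)) → 0`. Inputs: a static variance bound
  for one-body sums under canonical local Gibbs laws at small packing (cluster expansion; Ruelle1969 §4,
  tree `LocalGibbsConcentration` in content) and CLT-scale variance of the evolved field — the content of the sibling
  crux `CLTScaleConcentration` (stmt-15325) at horizon `s − r ≥ δ − d` (Duerinckx2021; EfronStein1981 for the
  Bessel/one-sphere-response form `(N+1)E[g(z₀)Ỹ] = E[g(z₀)·μ₁'(z₀)]`). Trivial (`M = B`) at constant profiles: `ψ_τ = ψ_{τ+r}`.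

ASSEMBLY `RenewalDefect_of : T → S → RenewalDefect` (real proof, no `sorry`): `η := min η_T η_S`, `σ₀ := min`,
both stubs called with `κ'/2`, `d₀ := min`, `N₀ := max`, then `|A − B| ≤ |A − M| + |M − B| ≤ κ'/2·d + κ'/2·d`
(`abs_sub_le`; the `let`s are definitionally transparent). The hypotheses are carried BY STUB NAME through the aliases
`__Registered.stub_*` (bodies verbatim the sorried theorems; the device of `Cruxes/ForwardMeanHydro/Lines/birth.lean`),
because the native skeleton audit admits a `Prop` hypothesis only if its head constant is a registered obligation or is
named like a declared stub; the closing `example : RenewalDefect := RenewalDefect_of stub_… stub_…` certifies the wiring.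

Hardest stub: `stub_transportDefect` (the crux's content; its "why it might fail" is the crux's). Not split further here:
the foreseen layer below T — (T1) the Duhamel representation of `A − M` along the interpolating family as a time integral
of the score/three-point covariance, (T2) Yau's cancellation of its hydrodynamic projection, (T3) an `O(1)`-per-unit-time
bound on the residual ⊥ three-point cumulant uniformly in `N` — needs the profile and collisional (contact-flux) scores
as typed objects and is left to the lead prover as `--supports` lemmas. Disproof used: none — `ledger crux ls
stmt-AtomisticToContinuum-15326`: no workfiles, no `Disproof.lean` at registration; negatives index (20 entries,
2026-08-17): no entry concerns renewal / time-shift identities or one-sphere covariances (the refuter stamp of the crux,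
2026-08-16, records "no negatives/barriers apply"). BC3 probes (`stub → RenewalDefect`, `stub → _root_.HydrodynamicLimit`
by `first | exact? | simpa | aesop`, plus the BC2 variants) fail for both stubs (planner folder `bc/`, record in `birth.md`).
Sources: Yau1991; OllaVaradhanYau1993 §3; Spohn1991 §7.1–7.2; Sasa2014; Gaspard2022 §3.2; EvansMorriss2008 Ch. 7;
Duerinckx2021; EfronStein1981; Ruelle1969 §4.
-/

namespace Summit.AtomisticToContinuum.HydrodynamicLimit.Cruxes.RenewalDefect.Birth

open scoped BigOperators Topology Classical MeasureTheory ProbabilityTheory InnerProductSpace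
open Filter Set Function TopologicalSpace MeasureTheory
open Literature.MathematicalPhysics.KineticTheory Literature.Analysis.FluidPDE
open Summit.AtomisticToContinuum.HydrodynamicLimit.Theses.ResponseRigidity (RenewalDefect)

/-! ## §1 The stub statements BY STUB NAME — the hypotheses of `RenewalDefect_of`

The native skeleton audit (`#h21_check_skeleton`, run by `ledger skeleton check`) admits a `Prop` hypothesis of the
composing theorem only if its HEAD CONSTANT is a registered obligation or is named like a declared stub (the `@[stub]`
tag is gate-reserved); so each stub statement is carried by the alias `abbrev __Registered.stub_X : Prop := …` (body
VERBATIM the sorried theorem `stub_X` of §2) and `RenewalDefect_of` is stated over the two aliases. The `__` namespace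
is an implementation detail, so the audit's stub report resolves each `stub_…` to the sorried theorem; the `example`s
after §2 certify alias = theorem statement definitionally. -/

namespace __Registered

/-- The statement of `stub_transportDefect` (T, load-bearing, open-problem), keyed by the registered stub name
(hypothesis of `RenewalDefect_of`; body VERBATIM the stub's). -/
abbrev stub_transportDefect : Prop :=
    ∃ η : ℝ, 0 < η ∧ ∀ (a₀ θ₀ : T3 → ℝ) (u₀ : T3 → V3), Continuous a₀ → Continuous θ₀ → Continuous u₀ → (∀ x,
    0 < a₀ x) → (∀ x, 0 < θ₀ x) → ∃ σ₀ : ℝ, 0 < σ₀ ∧ ∀ σ : ℝ, 0 < σ → σ < σ₀ → ∀ (T : ℝ) (ρ θ : ℝ → T3 → ℝ) (u : ℝ →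
    T3 → V3), IsHardSphereEulerSolution σ T ρ u θ → (∀ t ∈ Set.Ico 0 T, ∀ x, ρ t x * σ ^ 3 < η) → ∀ Φ : (N : ℕ) →
    HardSphereFlow (Torus.geometry (Fin 3)) (hsDiameter σ N) (N + 1),
    TendstoHydroFieldsAt (fun N => localGibbsLaw σ a₀ u₀ θ₀ N (Φ N)) Φ ρ u θ 0 → ∀ a : ℝ → T3 → ℝ, a 0 = a₀ →
    (∀ τ ∈ Set.Ico 0 T, Continuous (a τ) ∧ ∀ x, 0 < a τ x) → (∀ τ ∈ Set.Ico 0 T, ∀ χ : T3 → ℝ,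
    Literature.Analysis.FunctionSpaces.Torus.IsSmooth χ → Tendsto (fun N : ℕ => ∫ z,
    empiricalDensityField z χ ∂(localGibbsLaw σ (a τ) (u τ) (θ τ) N (Φ N))) atTop (𝓝 (∫ x, χ x * ρ τ x)) ∧
    (∀ j : Fin 3, Tendsto (fun N : ℕ => ∫ z,
    empiricalMomentumField z χ j ∂(localGibbsLaw σ (a τ) (u τ) (θ τ) N (Φ N))) atTop (𝓝 (∫ x,
    χ x * ρ τ x * u τ x j))) ∧ Tendsto (fun N : ℕ => ∫ z,
    empiricalEnergyField z χ ∂(localGibbsLaw σ (a τ) (u τ) (θ τ) N (Φ N))) atTop (𝓝 (∫ x,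
    χ x * totalEnergyDensity (ρ τ x) (u τ x) (θ τ x)))) → ∀ t ∈ Set.Ico 0 T, ∀ χ : T3 → ℝ,
    Literature.Analysis.FunctionSpaces.Torus.IsSmooth χ → ∀ φw : T3 → ℝ, Continuous φw → (∀ x, |φw x| ≤ 1) →
    ∀ p : V3 → ℝ, Continuous p → (∃ Cp : ℝ, ∀ c, |p c| ≤ Cp * (1 + ‖c‖ ^ 2) ^ 2) → ∀ δ : ℝ, 0 < δ → ∀ κ' : ℝ,
    0 < κ' → ∃ d₀ : ℝ, 0 < d₀ ∧ ∀ d : ℝ, 0 < d → d < d₀ → ∃ N₀ : ℕ, ∀ N : ℕ, N₀ ≤ N → ∀ s τ : ℝ, δ ≤ s → 0 ≤ τ →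
    s + τ ≤ t → let r : ℝ := d * ((N : ℝ) + 1) ^ (-(1 / 3 : ℝ));
    let P : Measure (Config (N + 1) (Fin 3) T3) := localGibbsLaw σ (a τ) (u τ) (θ τ) N (Φ N);
    let P' : Measure (Config (N + 1) (Fin 3) T3) := localGibbsLaw σ (a (τ + r)) (u (τ + r)) (θ (τ + r)) N (Φ N);
    let ψ : Config (N + 1) (Fin 3) T3 →
    ℝ := fun z => φw (z 0).1 * p ((Real.sqrt (θ τ (z 0).1))⁻¹ • ((z 0).2 - u τ (z 0).1));
    ∀ F₀ : Config (N + 1) (Fin 3) T3 → ℝ, (F₀ = (fun z => empiricalDensityField z χ) ∨ (∃ j : Fin 3,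
    F₀ = fun z => empiricalMomentumField z χ j) ∨ F₀ = fun z => empiricalEnergyField z χ) → |((N : ℝ) + 1) * ∫ z,
    ψ ((Φ N).flow r z) * (F₀ ((Φ N).flow s z) - ∫ w, F₀ ((Φ N).flow s w) ∂P) ∂P - ((N : ℝ) + 1) * ∫ z,
    ψ z * (F₀ ((Φ N).flow (s - r) z) - ∫ w, F₀ ((Φ N).flow (s - r) w) ∂P') ∂P'| ≤ κ' * d

/-- The statement of `stub_weightReframing` (S, size L), keyed by the registered stub name (hypothesis of
`RenewalDefect_of`; body VERBATIM the stub's). -/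
abbrev stub_weightReframing : Prop :=
    ∃ η : ℝ, 0 < η ∧ ∀ (a₀ θ₀ : T3 → ℝ) (u₀ : T3 → V3), Continuous a₀ → Continuous θ₀ → Continuous u₀ → (∀ x,
    0 < a₀ x) → (∀ x, 0 < θ₀ x) → ∃ σ₀ : ℝ, 0 < σ₀ ∧ ∀ σ : ℝ, 0 < σ → σ < σ₀ → ∀ (T : ℝ) (ρ θ : ℝ → T3 → ℝ) (u : ℝ →
    T3 → V3), IsHardSphereEulerSolution σ T ρ u θ → (∀ t ∈ Set.Ico 0 T, ∀ x, ρ t x * σ ^ 3 < η) → ∀ Φ : (N : ℕ) →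
    HardSphereFlow (Torus.geometry (Fin 3)) (hsDiameter σ N) (N + 1),
    TendstoHydroFieldsAt (fun N => localGibbsLaw σ a₀ u₀ θ₀ N (Φ N)) Φ ρ u θ 0 → ∀ a : ℝ → T3 → ℝ, a 0 = a₀ →
    (∀ τ ∈ Set.Ico 0 T, Continuous (a τ) ∧ ∀ x, 0 < a τ x) → (∀ τ ∈ Set.Ico 0 T, ∀ χ : T3 → ℝ,
    Literature.Analysis.FunctionSpaces.Torus.IsSmooth χ → Tendsto (fun N : ℕ => ∫ z,
    empiricalDensityField z χ ∂(localGibbsLaw σ (a τ) (u τ) (θ τ) N (Φ N))) atTop (𝓝 (∫ x, χ x * ρ τ x)) ∧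
    (∀ j : Fin 3, Tendsto (fun N : ℕ => ∫ z,
    empiricalMomentumField z χ j ∂(localGibbsLaw σ (a τ) (u τ) (θ τ) N (Φ N))) atTop (𝓝 (∫ x,
    χ x * ρ τ x * u τ x j))) ∧ Tendsto (fun N : ℕ => ∫ z,
    empiricalEnergyField z χ ∂(localGibbsLaw σ (a τ) (u τ) (θ τ) N (Φ N))) atTop (𝓝 (∫ x,
    χ x * totalEnergyDensity (ρ τ x) (u τ x) (θ τ x)))) → ∀ t ∈ Set.Ico 0 T, ∀ χ : T3 → ℝ,
    Literature.Analysis.FunctionSpaces.Torus.IsSmooth χ → ∀ φw : T3 → ℝ, Continuous φw → (∀ x, |φw x| ≤ 1) →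
    ∀ p : V3 → ℝ, Continuous p → (∃ Cp : ℝ, ∀ c, |p c| ≤ Cp * (1 + ‖c‖ ^ 2) ^ 2) → ∀ δ : ℝ, 0 < δ → ∀ κ' : ℝ,
    0 < κ' → ∃ d₀ : ℝ, 0 < d₀ ∧ ∀ d : ℝ, 0 < d → d < d₀ → ∃ N₀ : ℕ, ∀ N : ℕ, N₀ ≤ N → ∀ s τ : ℝ, δ ≤ s → 0 ≤ τ →
    s + τ ≤ t → let r : ℝ := d * ((N : ℝ) + 1) ^ (-(1 / 3 : ℝ));
    let P' : Measure (Config (N + 1) (Fin 3) T3) := localGibbsLaw σ (a (τ + r)) (u (τ + r)) (θ (τ + r)) N (Φ N);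
    let ψ : Config (N + 1) (Fin 3) T3 →
    ℝ := fun z => φw (z 0).1 * p ((Real.sqrt (θ τ (z 0).1))⁻¹ • ((z 0).2 - u τ (z 0).1));
    let ψ' : Config (N + 1) (Fin 3) T3 →
    ℝ := fun z => φw (z 0).1 * p ((Real.sqrt (θ (τ + r) (z 0).1))⁻¹ • ((z 0).2 - u (τ + r) (z 0).1));
    ∀ F₀ : Config (N + 1) (Fin 3) T3 → ℝ, (F₀ = (fun z => empiricalDensityField z χ) ∨ (∃ j : Fin 3,
    F₀ = fun z => empiricalMomentumField z χ j) ∨ F₀ = fun z => empiricalEnergyField z χ) → |((N : ℝ) + 1) * ∫ z,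
    ψ z * (F₀ ((Φ N).flow (s - r) z) - ∫ w, F₀ ((Φ N).flow (s - r) w) ∂P') ∂P' - ((N : ℝ) + 1) * ∫ z,
    ψ' z * (F₀ ((Φ N).flow (s - r) z) - ∫ w, F₀ ((Φ N).flow (s - r) w) ∂P') ∂P'| ≤ κ' * d

end __Registered

/-! ## §2 The registered stubs (`sorry` lives ONLY here; bodies VERBATIM the `__Registered` aliases) -/

/-- **STUB `stub_transportDefect` (T) — FROZEN-WEIGHT LAW-TRANSPORT DEFECT of the one-sphere renewal (OPEN; the
HARDEST stub, the crux's content).** Under the crux prefix verbatim (`∃ η` outermost, continuous positive profiles,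
`∃ σ₀`, `σ < σ₀`, packing-guarded classical hs-Euler solution on `[0,T)`, flows, LLN at `t = 0`, an Euler activity
family `a_τ` with the LLN of its local Gibbs laws, `t ∈ [0,T)`, smooth `χ`, `|φw| ≤ 1`, continuous `p` of quartic
growth, `δ > 0`, `κ' > 0`; `∃ d₀ ∀ d ∈ (0,d₀) ∃ N₀ ∀ N ≥ N₀ ∀ δ ≤ s, 0 ≤ τ, s + τ ≤ t`; `r := d(N+1)^{-1/3}`,
`P := LG_τ`, `P' := LG_{τ+r}`, `ψ := ψ_τ` the weight in the frame `(u_τ, θ_τ)`), for each of the three fields `F₀`: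
`|(N+1)∫ ψ(Φ_r z)(F₀(Φ_s z) − E_P[F₀∘Φ_s]) dP − (N+1)∫ ψ(z)(F₀(Φ_{s−r} z) − E_{P'}[F₀∘Φ_{s−r}]) dP'| ≤ κ'·d` —
reading the SAME weight `ψ_τ` on sphere `0` after the step under `LG_τ` is, to `o(d)`, reading it at time `0` under
the Euler-advanced law with the horizon shortened. Equivalently (flow property + exchangeability):
`|Cov_{Φ_r # LG_τ}(Σ_i ψ_τ(z_i), Y_{s−r}) − Cov_{LG_{τ+r}}(Σ_i ψ_τ(z_i), Y_{s−r})| ≤ κ'·d`. Why plausibly true: an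
identity at constant profiles (`Φ_r # LG = LG`, `P' = P`); in general the `ρ'`-derivative along
`Φ_{r−ρ'} # LG_{τ+ρ'}` is the three-point cumulant of (profile score − dynamical score, `ψ`-sum, future field), whose
hydrodynamic projection cancels along an Euler family (Yau) and whose ⊥-residue is a current fluctuation relaxing on
the kinetic scale — `O(1)` per unit macroscopic time would even give `O(d N^{-1/3})`. Why it might fail: the crux's —
`Φ_r # LG_τ` and `LG_{τ+r}` are far apart as measures (relative entropy `≍ d²N^{1/3}`, no entropy-inequality
shortcut), and the uniform-in-`N` bound on the mixed (⊥-score, one-sphere ⊥, far-future field) cumulant is a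
three-point additivity that could fail at `O(d)`. Size: open-problem. Leans on: `localGibbsLaw`, `HardSphereFlow.flow`,
`empiricalDensityField/MomentumField/EnergyField`, `IsHardSphereEulerSolution`, `TendstoHydroFieldsAt` (Literature);
Yau1991, OllaVaradhanYau1993 §3, Sasa2014, Gaspard2022 §3.2, EvansMorriss2008 Ch. 7, Spohn1991 §7.2. -/
theorem stub_transportDefect :
    ∃ η : ℝ, 0 < η ∧ ∀ (a₀ θ₀ : T3 → ℝ) (u₀ : T3 → V3), Continuous a₀ → Continuous θ₀ → Continuous u₀ → (∀ x,
    0 < a₀ x) → (∀ x, 0 < θ₀ x) → ∃ σ₀ : ℝ, 0 < σ₀ ∧ ∀ σ : ℝ, 0 < σ → σ < σ₀ → ∀ (T : ℝ) (ρ θ : ℝ → T3 → ℝ) (u : ℝ →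
    T3 → V3), IsHardSphereEulerSolution σ T ρ u θ → (∀ t ∈ Set.Ico 0 T, ∀ x, ρ t x * σ ^ 3 < η) → ∀ Φ : (N : ℕ) →
    HardSphereFlow (Torus.geometry (Fin 3)) (hsDiameter σ N) (N + 1),
    TendstoHydroFieldsAt (fun N => localGibbsLaw σ a₀ u₀ θ₀ N (Φ N)) Φ ρ u θ 0 → ∀ a : ℝ → T3 → ℝ, a 0 = a₀ →
    (∀ τ ∈ Set.Ico 0 T, Continuous (a τ) ∧ ∀ x, 0 < a τ x) → (∀ τ ∈ Set.Ico 0 T, ∀ χ : T3 → ℝ,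
    Literature.Analysis.FunctionSpaces.Torus.IsSmooth χ → Tendsto (fun N : ℕ => ∫ z,
    empiricalDensityField z χ ∂(localGibbsLaw σ (a τ) (u τ) (θ τ) N (Φ N))) atTop (𝓝 (∫ x, χ x * ρ τ x)) ∧
    (∀ j : Fin 3, Tendsto (fun N : ℕ => ∫ z,
    empiricalMomentumField z χ j ∂(localGibbsLaw σ (a τ) (u τ) (θ τ) N (Φ N))) atTop (𝓝 (∫ x,
    χ x * ρ τ x * u τ x j))) ∧ Tendsto (fun N : ℕ => ∫ z,
    empiricalEnergyField z χ ∂(localGibbsLaw σ (a τ) (u τ) (θ τ) N (Φ N))) atTop (𝓝 (∫ x,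
    χ x * totalEnergyDensity (ρ τ x) (u τ x) (θ τ x)))) → ∀ t ∈ Set.Ico 0 T, ∀ χ : T3 → ℝ,
    Literature.Analysis.FunctionSpaces.Torus.IsSmooth χ → ∀ φw : T3 → ℝ, Continuous φw → (∀ x, |φw x| ≤ 1) →
    ∀ p : V3 → ℝ, Continuous p → (∃ Cp : ℝ, ∀ c, |p c| ≤ Cp * (1 + ‖c‖ ^ 2) ^ 2) → ∀ δ : ℝ, 0 < δ → ∀ κ' : ℝ,
    0 < κ' → ∃ d₀ : ℝ, 0 < d₀ ∧ ∀ d : ℝ, 0 < d → d < d₀ → ∃ N₀ : ℕ, ∀ N : ℕ, N₀ ≤ N → ∀ s τ : ℝ, δ ≤ s → 0 ≤ τ →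
    s + τ ≤ t → let r : ℝ := d * ((N : ℝ) + 1) ^ (-(1 / 3 : ℝ));
    let P : Measure (Config (N + 1) (Fin 3) T3) := localGibbsLaw σ (a τ) (u τ) (θ τ) N (Φ N);
    let P' : Measure (Config (N + 1) (Fin 3) T3) := localGibbsLaw σ (a (τ + r)) (u (τ + r)) (θ (τ + r)) N (Φ N);
    let ψ : Config (N + 1) (Fin 3) T3 →
    ℝ := fun z => φw (z 0).1 * p ((Real.sqrt (θ τ (z 0).1))⁻¹ • ((z 0).2 - u τ (z 0).1));
    ∀ F₀ : Config (N + 1) (Fin 3) T3 → ℝ, (F₀ = (fun z => empiricalDensityField z χ) ∨ (∃ j : Fin 3,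
    F₀ = fun z => empiricalMomentumField z χ j) ∨ F₀ = fun z => empiricalEnergyField z χ) → |((N : ℝ) + 1) * ∫ z,
    ψ ((Φ N).flow r z) * (F₀ ((Φ N).flow s z) - ∫ w, F₀ ((Φ N).flow s w) ∂P) ∂P - ((N : ℝ) + 1) * ∫ z,
    ψ z * (F₀ ((Φ N).flow (s - r) z) - ∫ w, F₀ ((Φ N).flow (s - r) w) ∂P') ∂P'| ≤ κ' * d := by
  sorry

/-- **STUB `stub_weightReframing` (S) — WEIGHT RE-FRAMING DEFECT (size L; trivial at constant profiles).** Same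
prefix; `r := d(N+1)^{-1/3}`, `P' := LG_{τ+r}`, `ψ := ψ_τ` (frame `(u_τ,θ_τ)`), `ψ' := ψ_{τ+r}` (frame
`(u_{τ+r},θ_{τ+r})`); for each of the three fields `F₀`, with `Ỹ' := F₀(Φ_{s−r} z) − E_{P'}[F₀∘Φ_{s−r}]`:
`|(N+1)∫ ψ z · Ỹ' dP' − (N+1)∫ ψ' z · Ỹ' dP'| ≤ κ'·d` for `N ≥ N₀(d)` — i.e. (exchangeability)
`|Cov_{LG_{τ+r}}(Σ_i g(z_i), Y_{s−r})| ≤ κ'·d` with the frame difference `g := ψ_τ − ψ_{τ+r}`. Why plausibly true: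
`g → 0` locally uniformly with a quartic envelope as `r = d(N+1)^{-1/3} → 0` (continuity of `p`, `C¹`-in-time
classical solution; `τ + r ≤ t − δ + d < T` once `d₀ ≤ δ`), the local Gibbs one-body marginal has Gaussian velocity
tails, so `‖g‖_{L²} → 0`; then `|Cov(Σ g, Y)| ≤ SD(Σ_i g(z_i))·SD(Y_{s−r}) ≤ C√(N+1)‖g‖ · √(C/(N+1)) = o(1)`. Inputs:
(i) static variance of one-body sums under canonical local Gibbs laws at small packing, `Var(Σ g) ≤ C(N+1)‖g‖²`
(cluster expansion, Ruelle1969 §4; positional pair correlations live on the scale `σ(N+1)^{-1/3}`); (ii) CLT-scale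
variance `Var_{LG_{τ+r}}(Y_{s−r}) ≤ C/(N+1)` of the evolved field — the content of the sibling crux
`CLTScaleConcentration` (stmt-15325) at horizon `s − r ≥ δ − d`; equivalently the one-sphere-response form
`(N+1)E[g(z₀)Ỹ'] = E[g(z₀)μ₁'(z₀)]`, `‖μ₁'‖_{L²} = O(1)` by Bessel/Efron–Stein (EfronStein1981, Duerinckx2021). Why it
might fail: only through (ii) — super-CLT fluctuations of a conserved field at a positive time before the shock; with
mere LLN-scale `SD(Y) = o(1)` and `p` only continuous (no rate for `‖g‖`) the product bound does not close. Size: L.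
Leans on: `localGibbsLaw`, `HardSphereFlow.flow`, the three empirical fields, `IsHardSphereEulerSolution`
(time-regularity of `u, θ`); Spohn1991 §7.1, Duerinckx2021, EfronStein1981, Ruelle1969 §4. -/
theorem stub_weightReframing :
    ∃ η : ℝ, 0 < η ∧ ∀ (a₀ θ₀ : T3 → ℝ) (u₀ : T3 → V3), Continuous a₀ → Continuous θ₀ → Continuous u₀ → (∀ x,
    0 < a₀ x) → (∀ x, 0 < θ₀ x) → ∃ σ₀ : ℝ, 0 < σ₀ ∧ ∀ σ : ℝ, 0 < σ → σ < σ₀ → ∀ (T : ℝ) (ρ θ : ℝ → T3 → ℝ) (u : ℝ →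
    T3 → V3), IsHardSphereEulerSolution σ T ρ u θ → (∀ t ∈ Set.Ico 0 T, ∀ x, ρ t x * σ ^ 3 < η) → ∀ Φ : (N : ℕ) →
    HardSphereFlow (Torus.geometry (Fin 3)) (hsDiameter σ N) (N + 1),
    TendstoHydroFieldsAt (fun N => localGibbsLaw σ a₀ u₀ θ₀ N (Φ N)) Φ ρ u θ 0 → ∀ a : ℝ → T3 → ℝ, a 0 = a₀ →
    (∀ τ ∈ Set.Ico 0 T, Continuous (a τ) ∧ ∀ x, 0 < a τ x) → (∀ τ ∈ Set.Ico 0 T, ∀ χ : T3 → ℝ,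
    Literature.Analysis.FunctionSpaces.Torus.IsSmooth χ → Tendsto (fun N : ℕ => ∫ z,
    empiricalDensityField z χ ∂(localGibbsLaw σ (a τ) (u τ) (θ τ) N (Φ N))) atTop (𝓝 (∫ x, χ x * ρ τ x)) ∧
    (∀ j : Fin 3, Tendsto (fun N : ℕ => ∫ z,
    empiricalMomentumField z χ j ∂(localGibbsLaw σ (a τ) (u τ) (θ τ) N (Φ N))) atTop (𝓝 (∫ x,
    χ x * ρ τ x * u τ x j))) ∧ Tendsto (fun N : ℕ => ∫ z,
    empiricalEnergyField z χ ∂(localGibbsLaw σ (a τ) (u τ) (θ τ) N (Φ N))) atTop (𝓝 (∫ x,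
    χ x * totalEnergyDensity (ρ τ x) (u τ x) (θ τ x)))) → ∀ t ∈ Set.Ico 0 T, ∀ χ : T3 → ℝ,
    Literature.Analysis.FunctionSpaces.Torus.IsSmooth χ → ∀ φw : T3 → ℝ, Continuous φw → (∀ x, |φw x| ≤ 1) →
    ∀ p : V3 → ℝ, Continuous p → (∃ Cp : ℝ, ∀ c, |p c| ≤ Cp * (1 + ‖c‖ ^ 2) ^ 2) → ∀ δ : ℝ, 0 < δ → ∀ κ' : ℝ,
    0 < κ' → ∃ d₀ : ℝ, 0 < d₀ ∧ ∀ d : ℝ, 0 < d → d < d₀ → ∃ N₀ : ℕ, ∀ N : ℕ, N₀ ≤ N → ∀ s τ : ℝ, δ ≤ s → 0 ≤ τ →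
    s + τ ≤ t → let r : ℝ := d * ((N : ℝ) + 1) ^ (-(1 / 3 : ℝ));
    let P' : Measure (Config (N + 1) (Fin 3) T3) := localGibbsLaw σ (a (τ + r)) (u (τ + r)) (θ (τ + r)) N (Φ N);
    let ψ : Config (N + 1) (Fin 3) T3 →
    ℝ := fun z => φw (z 0).1 * p ((Real.sqrt (θ τ (z 0).1))⁻¹ • ((z 0).2 - u τ (z 0).1));
    let ψ' : Config (N + 1) (Fin 3) T3 →
    ℝ := fun z => φw (z 0).1 * p ((Real.sqrt (θ (τ + r) (z 0).1))⁻¹ • ((z 0).2 - u (τ + r) (z 0).1));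
    ∀ F₀ : Config (N + 1) (Fin 3) T3 → ℝ, (F₀ = (fun z => empiricalDensityField z χ) ∨ (∃ j : Fin 3,
    F₀ = fun z => empiricalMomentumField z χ j) ∨ F₀ = fun z => empiricalEnergyField z χ) → |((N : ℝ) + 1) * ∫ z,
    ψ z * (F₀ ((Φ N).flow (s - r) z) - ∫ w, F₀ ((Φ N).flow (s - r) w) ∂P') ∂P' - ((N : ℝ) + 1) * ∫ z,
    ψ' z * (F₀ ((Φ N).flow (s - r) z) - ∫ w, F₀ ((Φ N).flow (s - r) w) ∂P') ∂P'| ≤ κ' * d := by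
  sorry

-- wiring: the aliases ARE the registered statements (definitionally, by `rfl` of `abbrev`)
example : __Registered.stub_transportDefect := stub_transportDefect
example : __Registered.stub_weightReframing := stub_weightReframing

/-! ## §3 The assembly (real proof, no `sorry`) -/

/-- **THE SKELETON THEOREM — the two registered stubs (by name, via their `__Registered` aliases: frozen-weight
law-transport defect T, weight re-framing defect S) imply the crux `RenewalDefect` BY NAME.** Real proof, no `sorry`:
`η := min η_T η_S`, `σ₀ := min σ_T σ_S`, both stubs invoked with `κ'/2`, `d₀ := min`, `N₀ := max`; for each field
`F₀` the crux's defect `|A − B|` is at most `|A − M| + |M − B| ≤ κ'/2·d + κ'/2·d = κ'·d` (`abs_sub_le`), the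
intermediate `M` (old frame `ψ_τ`, new law `LG_{τ+r}`) being literally T's second and S's first term. -/
theorem RenewalDefect_of :
    __Registered.stub_transportDefect →
    __Registered.stub_weightReframing →
    RenewalDefect := by
  intro hT hS
  obtain ⟨η₁, hη₁, H₁⟩ := hT
  obtain ⟨η₂, hη₂, H₂⟩ := hS
  refine ⟨min η₁ η₂, lt_min hη₁ hη₂, fun a₀ θ₀ u₀ ha hθ hu ha0 hθ0 => ?_⟩
  obtain ⟨σ₁, hσ₁, G₁⟩ := H₁ a₀ θ₀ u₀ ha hθ hu ha0 hθ0
  obtain ⟨σ₂, hσ₂, G₂⟩ := H₂ a₀ θ₀ u₀ ha hθ hu ha0 hθ0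
  refine ⟨min σ₁ σ₂, lt_min hσ₁ hσ₂, ?_⟩
  intro σ hσ hσ' T ρ θ u hsol hpack Φ h0 a ha0' haτ hmean t ht χ hχ φw hφw hφw1 p hp hpg δ hδ κ' hκ'
  obtain ⟨hσ₁', hσ₂'⟩ := lt_min_iff.mp hσ'
  -- the two packing guards
  have hg₁ : ∀ t' ∈ Set.Ico 0 T, ∀ x, ρ t' x * σ ^ 3 < η₁ := fun t' ht' x =>
    (hpack t' ht' x).trans_le (min_le_left _ _)
  have hg₂ : ∀ t' ∈ Set.Ico 0 T, ∀ x, ρ t' x * σ ^ 3 < η₂ := fun t' ht' x =>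
    (hpack t' ht' x).trans_le (min_le_right _ _)
  have hκ2 : 0 < κ' / 2 := half_pos hκ'
  -- both stubs with tolerance κ'/2
  obtain ⟨d₁, hd₁, D₁⟩ :=
    G₁ σ hσ hσ₁' T ρ θ u hsol hg₁ Φ h0 a ha0' haτ hmean t ht χ hχ φw hφw hφw1 p hp hpg δ hδ (κ' / 2) hκ2
  obtain ⟨d₂, hd₂, D₂⟩ :=
    G₂ σ hσ hσ₂' T ρ θ u hsol hg₂ Φ h0 a ha0' haτ hmean t ht χ hχ φw hφw hφw1 p hp hpg δ hδ (κ' / 2) hκ2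
  refine ⟨min d₁ d₂, lt_min hd₁ hd₂, fun d hd hdd => ?_⟩
  obtain ⟨hdd₁, hdd₂⟩ := lt_min_iff.mp hdd
  obtain ⟨N₁, E₁⟩ := D₁ d hd hdd₁
  obtain ⟨N₂, E₂⟩ := D₂ d hd hdd₂
  refine ⟨max N₁ N₂, fun N hN s τ hs hτ hst => ?_⟩
  have e₁ := E₁ N ((le_max_left _ _).trans hN) s τ hs hτ hst
  have e₂ := E₂ N ((le_max_right _ _).trans hN) s τ hs hτ hst
  intro r P P' ψ ψ' F₀ hF₀
  have f₁ := e₁ F₀ hF₀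
  have f₂ := e₂ F₀ hF₀
  have hsum : κ' / 2 * d + κ' / 2 * d = κ' * d := by ring
  calc _ ≤ _ + _ := abs_sub_le _ _ _
    _ ≤ κ' / 2 * d + κ' / 2 * d := add_le_add f₁ f₂
    _ = κ' * d := hsum

/-- The two registered stubs fill the two hypotheses (wiring check: the registered signatures ARE, definitionally,
the hypotheses of `RenewalDefect_of`; an `example`, so the skeleton theorem stays the unique local theorem concluding
the crux; it depends on the stubs' `sorry`, declares none). -/
example : RenewalDefect := RenewalDefect_of stub_transportDefect stub_weightReframing

end Summit.AtomisticToContinuum.HydrodynamicLimit.Cruxes.RenewalDefect.Birth
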